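import Summits.BirchSwinnertonDyer.BirchSwinnertonDyer.Theorems.EisensteinPrimesBSDpOnCellCRetractionSpecializationHerbrand
import HarnessLib

/-!
# Specialisation of characteristic ideals along a retraction `φ : B → A` with kernel `(π)`:
# the regularity clause `∃ s ∉ (π), s·N = 0`, and the pseudo-isomorphism shape (proofs)

Helper file for crux 4 `BSDpOnCellC` (stmt-BirchSwinnertonDyer-19034, line «telescope» v4; width seat `bsd-line-x2-p2`,
`--supports`). Sequel of `…RetractionSpecializationCyclic/Herbrand.lean`. The registered research stub
`stub_carrierAlgW` asks, for every member `k`, for a REGULARITY element `s_k ∉ (X − x_k)` with `s_k·𝒩 = 0`; this file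
proves, for a general retraction `(B, π, φ)`, the three equivalent readings of that clause and the (RES)-shaped
one-sided specialisation, all as pure commutative algebra:

* `charIdeal_le_of_lengthAt_ne_zero` — generic: for a finitely generated module `M` over a Noetherian domain `R`
  killed by some `s ≠ 0`, `ℓ_𝔮(M) ≠ 0` at a height-one prime `𝔮` forces `char_R(M) ≤ 𝔮`;
* `exists_not_dvd_smul_eq_zero_of_not_dvd` — **generator reading**: `N` finitely generated torsion over `B`,
  `char_B N = (F)`, `π ∤ F` (`π ≠ 0`) ⟹ `∃ s, π ∤ s ∧ s·N = 0`; and the converse `not_dvd_of_charIdeal_eq_span`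
  (`B` factorial);
* `isTorsion_quotSMulTop_of_exists_not_dvd` / `exists_not_dvd_smul_eq_zero_of_isTorsion_quotSMulTop` — **fibre
  reading**: `∃ s, π ∤ s ∧ s·N = 0` ⟺ `N/πN` is `A`-torsion (for `N` finitely generated over `B`; determinant trick,
  the tree's `LocalLength.lengthAt_eq_zero_of_forall_exists_notMem`);
* `charIdeal_le_map_of_retraction_of_isPseudoIsomorphism` / `_of_injective` / `_of_surjective` — **(RES) shapes**:
  for an `A`-linear pseudo-isomorphism `f : N/πN → Y`, an injection `N/πN ↪ Y` or a surjection `Y ↠ N/πN` (`Y`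
  finitely generated torsion), `char_A(Y) ≤ φ(char_B N)` (tree `charIdeal_eq_of_arePseudoIsomorphic` /
  `charIdeal_eq_mul_of_exact` ∘ `charIdeal_quotSMulTop_le_map_of_retraction`).

Theorems only, [folklore]; nothing about elliptic curves is asserted; no summit statement, crux or stub is proved here;
BSD is proved for no curve.

## References

* N. Bourbaki, *Algèbre commutative*, Ch. VII §4.4–4.5. [BourbakiAC5to7]
* H. Matsumura, *Commutative Ring Theory*, Thm. 2.1 (determinant trick). [Matsumura1987]
-/

noncomputable section

open Function
open scoped Pointwise

-- D-0017: single-problem summit, the namespace repeats the problem name by design.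
set_option linter.dupNamespace false
set_option autoImplicit false

namespace Summit.BirchSwinnertonDyer.BirchSwinnertonDyer.Theorems.RetractionSpecialization

open Literature.NumberTheory.EllipticCurves Literature.NumberTheory.EllipticCurves.Module
open Summit.BirchSwinnertonDyer.BirchSwinnertonDyer.Theorems.SignedBaseChangeAcDivSpecialization
open Summit.BirchSwinnertonDyer.BirchSwinnertonDyer.Theorems.SignedBaseChangeAcDivSpecialization.LocalLength

universe u w v

/-! ### Generic: a positive local length puts the characteristic ideal inside the prime -/

section Generic

variable {R : Type u} [CommRing R] [IsNoetherianRing R] [IsDomain R] {M : Type v} [AddCommGroup M] [Module R M]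
  [Module.Finite R M]

/-- For a finitely generated module `M` over a Noetherian domain killed by some `s ≠ 0` and a height-one prime `𝔮`
with `ℓ_𝔮(M) ≠ 0`: `char_R(M) ≤ 𝔮` (the factor `𝔮^{ℓ_𝔮(M)}`, `ℓ_𝔮(M)` finite and positive, divides the finite
product `char_R(M)`). [folklore] -/
theorem charIdeal_le_of_lengthAt_ne_zero {s : R} (hs : s ≠ 0) (hsM : Module.IsTorsionBy R M s)
    {𝔮 : PrimeSpectrum R} (h𝔮 : 𝔮.asIdeal.height = 1) (hℓ : lengthAt R M 𝔮 ≠ 0) :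
    charIdeal R M ≤ 𝔮.asIdeal := by
  have hfin := finite_heightOne_inter_mulSupport hs hsM
  have hne : lengthAt R M 𝔮 ≠ ⊤ := lengthAt_ne_top_of_isTorsionBy hs hsM 𝔮 (le_of_eq h𝔮)
  have hn : (lengthAt R M 𝔮).toNat ≠ 0 := by
    rw [Ne, ENat.toNat_eq_zero]
    push Not
    exact ⟨hℓ, hne⟩
  have hdvd : 𝔮.asIdeal ^ (lengthAt R M 𝔮).toNat ∣ charIdeal R M := by
    unfold charIdeal
    rw [finprod_mem_def]
    have h := finprod_mem_dvd (f := Set.mulIndicator {𝔭 : PrimeSpectrum R | 𝔭.asIdeal.height = 1}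
      fun 𝔭 => 𝔭.asIdeal ^ (lengthAt R M 𝔭).toNat) 𝔮
      (show (Function.mulSupport _).Finite by rw [Set.mulSupport_mulIndicator]; exact hfin)
    rwa [Set.mulIndicator_of_mem (show 𝔮 ∈ {𝔭 : PrimeSpectrum R | 𝔭.asIdeal.height = 1} from h𝔮)]
      at h
  exact (Ideal.le_of_dvd hdvd).trans (Ideal.pow_le_self hn)

end Generic

variable {A : Type u} {B : Type w} [CommRing A] [CommRing B] {π : B} {φ : B →+* A}
  {N : Type v} [AddCommGroup N] [Module B N]

/-! ### Generator reading: `π ∤ F` -/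

section Generator

variable [IsDomain A] [IsDomain B] [IsNoetherianRing B]

/-- **`π ∤ char_B N` ⟹ regularity.** For `π ≠ 0` (`(π) = ker φ` prime), `N` finitely generated over the Noetherian
domain `B` and killed by some `t ≠ 0`, with `char_B N = (F)` and `π ∤ F`: some `s` with `π ∤ s` kills `N` (otherwise
`ℓ_{(π)}(N) ≠ 0` and `char_B N ≤ (π)`). [folklore] -/
theorem exists_not_dvd_smul_eq_zero_of_not_dvd (hφπ : φ π = 0) (hker : ∀ b : B, φ b = 0 → π ∣ b)
    (hπ0 : π ≠ 0) [Module.Finite B N] {t : B} (ht0 : t ≠ 0) (ht : ∀ m : N, t • m = 0)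
    {F : B} (hF : charIdeal B N = Ideal.span {F}) (hπF : ¬ π ∣ F) :
    ∃ s : B, ¬ π ∣ s ∧ ∀ m : N, s • m = 0 := by
  let PX : PrimeSpectrum B := ⟨Ideal.span {π}, isPrime_span hφπ hker⟩
  rcases eq_or_ne (lengthAt B N PX) 0 with h0 | hne
  · obtain ⟨s, hsX, hs⟩ := exists_notMem_forall_smul_eq_zero_of_lengthAt_eq_zero h0
    exact ⟨s, fun h => hsX (Ideal.mem_span_singleton.mpr h), hs⟩
  · have hle : charIdeal B N ≤ PX.asIdeal :=
      charIdeal_le_of_lengthAt_ne_zero (𝔮 := PX) ht0 (fun m => ht m) (height_span_eq_one hφπ hker hπ0) hne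
    have hFmem : F ∈ charIdeal B N := by rw [hF]; exact Ideal.mem_span_singleton_self F
    exact absurd (Ideal.mem_span_singleton.mp (hle hFmem)) hπF

/-- **Regularity ⟹ `π ∤ char_B N`** (`B` factorial, `π ≠ 0`): if some `s` with `π ∤ s` kills `N` then NO generator
of `char_B N` is divisible by `π`. [folklore] -/
theorem not_dvd_of_charIdeal_eq_span [UniqueFactorizationMonoid B] (hφπ : φ π = 0)
    (hker : ∀ b : B, φ b = 0 → π ∣ b) (hπ0 : π ≠ 0)
    (hs : ∃ s : B, ¬ π ∣ s ∧ ∀ m : N, s • m = 0) {F : B} (hF : charIdeal B N = Ideal.span {F}) :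
    ¬ π ∣ F := by
  obtain ⟨s, hπs, hs⟩ := hs
  have hs0 : φ s ≠ 0 := fun h => hπs (hker s h)
  obtain ⟨F', hF', hF'0⟩ := exists_charIdeal_eq_span_of_retraction (N := N) hφπ hker hπ0 hs0 hs
  intro hπF
  have hFF' : Ideal.span ({F'} : Set B) ≤ Ideal.span {F} := by rw [← hF, ← hF']
  have hdvd : F ∣ F' := Ideal.mem_span_singleton.mp (hFF' (Ideal.mem_span_singleton_self F'))
  obtain ⟨c, hc⟩ := hπF.trans hdvd
  exact hF'0 (by rw [hc, map_mul, hφπ, zero_mul])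

end Generator

/-! ### Fibre reading: `N/πN` is `A`-torsion -/

section Fibre

variable [Algebra A B] [Module A N] [IsScalarTower A B N]

/-- **Regularity ⟹ torsion fibre**: if some `s` with `π ∤ s` kills `N` then `φ s ≠ 0` kills `N/πN`, which is
therefore `A`-torsion (`A` a domain). [folklore] -/
theorem isTorsion_quotSMulTop_of_exists_not_dvd [IsDomain A] (hφ : ∀ a : A, φ (algebraMap A B a) = a)
    (hker : ∀ b : B, φ b = 0 → π ∣ b) (hs : ∃ s : B, ¬ π ∣ s ∧ ∀ m : N, s • m = 0) :
    Module.IsTorsion A (QuotSMulTop π N) := by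
  obtain ⟨s, hπs, hs⟩ := hs
  have hs0 : φ s ≠ 0 := fun h => hπs (hker s h)
  have h1 := (isTorsionBy_map_of_retraction' (N := N) hφ hker hs).1
  exact fun m => ⟨⟨φ s, mem_nonZeroDivisors_of_ne_zero hs0⟩, @h1 m⟩

/-- **Torsion fibre ⟹ regularity** (determinant trick): if `N` is finitely generated over `B` and `N/πN` is
`A`-torsion, then some `s` with `π ∤ s` kills `N` (`N_{(π)} = 0` by Cayley–Hamilton / Nakayama at the prime
`(π) = ker φ`, tree `LocalLength.lengthAt_eq_zero_of_forall_exists_notMem`). No torsion hypothesis on `N` is needed.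
[cite: Matsumura1987, Thm. 2.1] -/
theorem exists_not_dvd_smul_eq_zero_of_isTorsion_quotSMulTop [IsDomain A]
    (hφ : ∀ a : A, φ (algebraMap A B a) = a) (hφπ : φ π = 0) (hker : ∀ b : B, φ b = 0 → π ∣ b)
    [Module.Finite B N] (hq : Module.IsTorsion A (QuotSMulTop π N)) :
    ∃ s : B, ¬ π ∣ s ∧ ∀ m : N, s • m = 0 := by
  let PX : PrimeSpectrum B := ⟨Ideal.span {π}, isPrime_span hφπ hker⟩
  have h0 : lengthAt B N PX = 0 := by
    refine lengthAt_eq_zero_of_forall_exists_notMem PX fun m => ?_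
    obtain ⟨a, ha⟩ := @hq (Submodule.Quotient.mk m)
    refine ⟨algebraMap A B a, fun h => ?_, ?_⟩
    · exact nonZeroDivisors.coe_ne_zero a
        (by rw [← hφ (a : A)]; exact (mem_span_iff_map_eq_zero hφπ hker).mp h)
    · have h : Submodule.Quotient.mk (p := (π • ⊤ : Submodule B N)) ((a : A) • m) = 0 := by
        rw [Submodule.Quotient.mk_smul]; exact ha
      rw [Submodule.Quotient.mk_eq_zero] at h
      rw [algebraMap_smul]
      change (a : A) • m ∈ (Ideal.span {π} • ⊤ : Submodule B N)
      rwa [Submodule.ideal_span_singleton_smul]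
  obtain ⟨s, hsX, hs⟩ := exists_notMem_forall_smul_eq_zero_of_lengthAt_eq_zero h0
  exact ⟨s, fun h => hsX (Ideal.mem_span_singleton.mpr h), hs⟩

end Fibre

/-! ### The (RES) shape: one-sided specialisation through a pseudo-isomorphism -/

section PseudoIso

variable [Algebra A B] [IsDomain A] [IsNoetherianRing A] [UniqueFactorizationMonoid A]
  [IsDomain B] [IsNoetherianRing B] [UniqueFactorizationMonoid B]
  [Module A N] [IsScalarTower A B N] [Module.Finite B N]
  {Y : Type*} [AddCommGroup Y] [Module A Y]

/-- **One-sided specialisation, (RES) shape.** If `f : N/πN → Y` is an `A`-linear pseudo-isomorphism (pseudo-null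
kernel and cokernel) and some `s ∉ (π)` kills the finitely generated `B`-module `N`, then
`char_A(Y) ≤ φ(char_B N)` (`char_A(Y) = char_A(N/πN)` by the tree's `charIdeal_eq_of_arePseudoIsomorphic`, then
`charIdeal_quotSMulTop_le_map_of_retraction`). The shape in which member control feeds the telescope: `Y` = the member's
Selmer dual, `f` = the control map. [folklore] -/
theorem charIdeal_le_map_of_retraction_of_isPseudoIsomorphism (hφ : ∀ a : A, φ (algebraMap A B a) = a)
    (hφπ : φ π = 0) (hker : ∀ b : B, φ b = 0 → π ∣ b)
    (hs : ∃ s : B, ¬ π ∣ s ∧ ∀ m : N, s • m = 0)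
    (f : QuotSMulTop π N →ₗ[A] Y) (hf : f.IsPseudoIsomorphism) :
    charIdeal A Y ≤ (charIdeal B N).map φ := by
  rw [← charIdeal_eq_of_arePseudoIsomorphic ⟨f, hf⟩]
  exact charIdeal_quotSMulTop_le_map_of_retraction hφ hφπ hker N hs


/-- **One-sided specialisation through an INJECTION `N/πN ↪ Y`** (`Y` finitely generated torsion over `A`):
`char_A(Y) = char_A(N/πN) · char_A(Y / N/πN) ≤ char_A(N/πN) ≤ φ(char_B N)` (multiplicativity, tree
`charIdeal_eq_mul_of_exact`). The COKERNEL-free half of control: an injection of the fibre into the member dual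
already bounds the member's characteristic ideal by the specialised two-variable one. [folklore] -/
theorem charIdeal_le_map_of_retraction_of_injective (hφ : ∀ a : A, φ (algebraMap A B a) = a)
    (hφπ : φ π = 0) (hker : ∀ b : B, φ b = 0 → π ∣ b)
    (hs : ∃ s : B, ¬ π ∣ s ∧ ∀ m : N, s • m = 0) [Module.Finite A Y] (hY : Module.IsTorsion A Y)
    (f : QuotSMulTop π N →ₗ[A] Y) (hf : Injective f) :
    charIdeal A Y ≤ (charIdeal B N).map φ := by
  rw [charIdeal_eq_mul_of_exact hY f (LinearMap.range f).mkQ hf (Submodule.mkQ_surjective _)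
    (LinearMap.exact_map_mkQ_range f)]
  exact Ideal.mul_le_right.trans (charIdeal_quotSMulTop_le_map_of_retraction hφ hφπ hker N hs)

/-- **One-sided specialisation through a SURJECTION `Y ↠ N/πN`** (`Y` finitely generated torsion over `A`):
`char_A(Y) = char_A(ker) · char_A(N/πN) ≤ φ(char_B N)`. [folklore] -/
theorem charIdeal_le_map_of_retraction_of_surjective (hφ : ∀ a : A, φ (algebraMap A B a) = a)
    (hφπ : φ π = 0) (hker : ∀ b : B, φ b = 0 → π ∣ b)
    (hs : ∃ s : B, ¬ π ∣ s ∧ ∀ m : N, s • m = 0) [Module.Finite A Y] (hY : Module.IsTorsion A Y)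
    (g : Y →ₗ[A] QuotSMulTop π N) (hg : Surjective g) :
    charIdeal A Y ≤ (charIdeal B N).map φ := by
  rw [charIdeal_eq_mul_of_exact hY (LinearMap.ker g).subtype g (Submodule.injective_subtype _) hg
    (LinearMap.exact_subtype_ker_map g)]
  exact Ideal.mul_le_left.trans (charIdeal_quotSMulTop_le_map_of_retraction hφ hφπ hker N hs)

end PseudoIso

end Summit.BirchSwinnertonDyer.BirchSwinnertonDyer.Theorems.RetractionSpecialization

end
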